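import Literature.Probability.RandomMatrix.TwoQubitSeparabilityVolumes
import Literature.NumberTheory.Transcendental.KZCalculus
import HarnessLib

/-!
# Huong–Khoi's `8/33` as an identity of Kontsevich–Zagier integral representations

Bridge (PROVED, no new named fact) between the tree's named fact
`Literature.Probability.RandomMatrix.HuongKhoi2024_qubit_separability_probability`
(`33 · vol₁₅ {ρ ≽ 0, ρ^Γ ≽ 0} = 8 · vol₁₅ {ρ ≽ 0}` on the entry chart `ℝ¹⁵` of trace-one Hermitian
`4 × 4` matrices, `TwoQubitSeparabilityVolumes.lean`) and the shape in which route
`Summit.KontsevichZagierPeriods.KontsevichZagierPeriods.Theses.SpectrahedralScissors` consumes it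
(item `SectorOfSummit` (b), cite item `wi-19727`): for the typed integral representations
`r = ∫_{P_ℂ} 33` and `r' = ∫_{D_ℂ} 8` of the complex conjunct of `Transport` (KZ calculus,
`Literature.NumberTheory.Transcendental.KZ.IntegralRep`), `r.value = r'.value`.

The route binds the chart as hypotheses `∀ y, ρ y = !![…]`, `∀ y, ρ' y = !![…]` with the literal
matrices of `twoQubitMatrix` / `twoQubitMatrixPT`; the theorem below is stated with exactly these
binders, so it applies verbatim. Proof: the two domains are the chart bodies; a KZ representation
with integrand constantly `c` on its domain `σ` has value `c · (volume σ).toReal`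
(`setIntegral_const`), and `volume σ < ∞` because a non-zero constant is integrable on `σ`
(`r.integrableOn`); apply `ENNReal.toReal` to the named fact.

Sources: H. Thanh Huong, V. The Khoi, J. Phys. A 57 (2024) 445304 [HuongKhoi2024] (the value
`8/33`; paywalled, read through Zhang–Jiang–Xie); L. Zhang, X. Jiang, B. Xie, QIC 25 (2025),
Thm. 6.12 [ZhangJiangXie2025]; M. Kontsevich, D. Zagier, *Periods* (2001), §1.1 (integral
representations) [KontsevichZagier2001].
-/

noncomputable section

open MeasureTheory Set
open scoped ComplexOrder

namespace Literature.Probability.RandomMatrix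

open Literature.NumberTheory.Transcendental

/-- The value of a KZ integral representation whose integrand is constantly `c` on its domain is
`c · vol(domain)`, and the domain has finite volume as soon as `c ≠ 0` (absolute integrability is
part of the datum). [cite: KontsevichZagier2001, §1.1] -/
theorem KZ_value_of_eqOn_const {n : ℕ} (r : KZ.IntegralRep n) {c : ℝ} (hc : c ≠ 0)
    (hr : EqOn r.integrand (fun _ => c) r.domain) :
    volume r.domain < ⊤ ∧ r.value = c * (volume r.domain).toReal := by
  have hm : MeasurableSet r.domain := KZ.IntegralRep.measurableSet_domain_holds r
  have hint : IntegrableOn (fun _ : Fin n → ℝ => c) r.domain volume :=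
    r.integrableOn.congr_fun hr hm
  have hfin : volume r.domain < ⊤ := by
    have := (integrableOn_const_iff (C := c) (s := r.domain) (μ := volume)).1 hint
    exact this.resolve_left fun h0 => hc (enorm_eq_zero.1 h0)
  refine ⟨hfin, ?_⟩
  rw [KZ.IntegralRep.value, setIntegral_congr_fun hm hr, setIntegral_const, smul_eq_mul, mul_comm]
  rfl

/-- **Huong–Khoi's `8/33` in the Kontsevich–Zagier calculus** (shape of route
SpectrahedralScissors, `SectorOfSummit` (b) / complex conjunct of `Transport`): granted the named
fact `HuongKhoi2024_qubit_separability_probability`, for the two-qubit chart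
`ρ(y) = [[X, Z], [Z*, Y]]`, `ρ'(y) = ρ(y)^Γ = [[X, Z*], [Z, Y]]` on `ℝ¹⁵` and any KZ integral
representations `r = ∫_{ρ ≽ 0, ρ' ≽ 0} 33`, `r' = ∫_{ρ ≽ 0} 8`, the represented numbers agree:
`33 · vol(P_ℂ) = 8 · vol(D_ℂ)` (Hilbert–Schmidt separability probability `8/33`).
[cite: HuongKhoi2024, main theorem] [cite: ZhangJiangXie2025, Theorem 6.12] -/
theorem HuongKhoi2024_qubit_separability_probability.kz_value_eq
    (h : HuongKhoi2024_qubit_separability_probability) :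
    ∀ (ρ ρ' : (Fin 15 → ℝ) → Matrix (Fin 4) (Fin 4) ℂ),
      (∀ y, ρ y = !![((y 0 : ℝ) : ℂ), (⟨y 2, y 3⟩ : ℂ), (⟨y 7, y 8⟩ : ℂ), (⟨y 9, y 10⟩ : ℂ);
        (⟨y 2, -y 3⟩ : ℂ), ((y 1 : ℝ) : ℂ), (⟨y 11, y 12⟩ : ℂ), (⟨y 13, y 14⟩ : ℂ);
        (⟨y 7, -y 8⟩ : ℂ), (⟨y 11, -y 12⟩ : ℂ), ((y 4 : ℝ) : ℂ), (⟨y 5, y 6⟩ : ℂ);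
        (⟨y 9, -y 10⟩ : ℂ), (⟨y 13, -y 14⟩ : ℂ), (⟨y 5, -y 6⟩ : ℂ), ((1 - y 0 - y 1 - y 4 : ℝ) : ℂ)]) →
      (∀ y, ρ' y = !![((y 0 : ℝ) : ℂ), (⟨y 2, y 3⟩ : ℂ), (⟨y 7, -y 8⟩ : ℂ), (⟨y 11, -y 12⟩ : ℂ);
        (⟨y 2, -y 3⟩ : ℂ), ((y 1 : ℝ) : ℂ), (⟨y 9, -y 10⟩ : ℂ), (⟨y 13, -y 14⟩ : ℂ);
        (⟨y 7, y 8⟩ : ℂ), (⟨y 9, y 10⟩ : ℂ), ((y 4 : ℝ) : ℂ), (⟨y 5, y 6⟩ : ℂ);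
        (⟨y 11, y 12⟩ : ℂ), (⟨y 13, y 14⟩ : ℂ), (⟨y 5, -y 6⟩ : ℂ), ((1 - y 0 - y 1 - y 4 : ℝ) : ℂ)]) →
      ∀ (r r' : KZ.IntegralRep 15),
        r.domain = {y | (ρ y).PosSemidef ∧ (ρ' y).PosSemidef} →
        EqOn r.integrand (fun _ => 33) r.domain →
        r'.domain = {y | (ρ y).PosSemidef} →
        EqOn r'.integrand (fun _ => 8) r'.domain →
        r.value = r'.value := by
  intro ρ ρ' hρ hρ' r r' hr hr33 hr' hr8
  -- the binders are the chart
  have eρ : ρ = twoQubitMatrix := funext fun y => (hρ y).trans rfl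
  have eρ' : ρ' = twoQubitMatrixPT := funext fun y => (hρ' y).trans rfl
  subst eρ eρ'
  obtain ⟨hPfin, hPval⟩ := KZ_value_of_eqOn_const r (by norm_num) hr33
  obtain ⟨hDfin, hDval⟩ := KZ_value_of_eqOn_const r' (by norm_num) hr8
  rw [hPval, hDval, hr, hr']
  rw [hr] at hPfin
  rw [hr'] at hDfin
  -- `33 · vol P = 8 · vol D` in `ℝ≥0∞`, both finite
  have key := congrArg ENNReal.toReal h
  rw [ENNReal.toReal_mul, ENNReal.toReal_mul] at key
  norm_num at key
  linarith [key]

end Literature.Probability.RandomMatrix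

end
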